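import Summits.Ventures.CertifiedQuantumChemistry.Rows.LevelShiftTempleRows
import Summits.Ventures.CertifiedQuantumChemistry.Rows.LinearCombination
import HarnessLib

/-!
# Ventures/CertifiedQuantumChemistry — Rows/CompactChordRows.lean: the COMPACT-SIDE CHORD row
# (door M1′, I-DIFF wave 2 lens L3 «compact chord», chem-idea-7; W2L3-P2 INSTANCE1-SPEC §(d))

HONEST FRAMING (verbatim): certified bounds for a stated model Hamiltonian in a stated basis; not a
claim about the real molecule or material beyond that model. This file certifies no number: it is the
ONE-DECL row shape a «compact-chord bracket» row of `CERTIFIED-CHEM.md` instantiates.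

WHAT IS TYPED (chem-type-07, B8-1; zero new mathematics — every theorem is a composition of tree lemmas,
exactly as chem-idea-7's kernel SKETCHES `HOME/idea/wave2/L3-compact-chord/CompactChordSketch.lean` /
`CompactChordOpenShellSketch.lean` check them; landed here so that a row's Lean cell is a three-line
instantiation instead of an inline re-derivation). Objects: a symmetric model `F` (the PARENT), a weight file
`W` (door M1: `W = Model.diagWeight 1_J μ`, closed shell; or `Model.diagWeight w μ` with threshold data,
open shell), the SHIFTED file of record `F_λ = Model.lincomb 1 λ F W` carrying a certified lower row `ℓ`
(the β leg), and the DERIVED COMPACT-SIDE file `F₋ₐ = Model.lincomb 1 (−a) F W` (`a > 0`).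
* §1 table identities (`Model.ext'`, `Model.lincomb_lincomb`): `F_λ` is the level shift of `F₋ₐ` by
  `a + λ` (`Model.lincomb_compact_shift`), and `F` is the convex combination `(λ·F₋ₐ + a·F_λ)/(a + λ)`
  (`Model.lincomb_chord`).
* §2 GAP TRANSPORT: the β leg certifies the gap AT THE COMPACT-SIDE FILE — closed shell
  (`gapCertificate_compact_of_lowerRow_closedShell`, level `ℓ − (a+λ)(2|J| − 1 − μ)`, `= ℓ` for the door-M1
  choice `μ = 2|J| − 1`) and threshold template (`gapCertificate_compact_of_lowerRow_thresholds`) — by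
  `gapCertificate_of_lowerRow_closedShell` / `…_levelShift_thresholds` (Rows/LevelShiftTempleRows.lean)
  after rewriting with §1.
* §3 THE CHORD ROW (operator concavity = `LowerRow.lincomb`, Rows/LinearCombination.lean): lower rows `T`
  of `F₋ₐ` and `β` of `F_λ` give `LowerRow F a b ((λ·T + a·β)/(a + λ))` (`LowerRow.chord`); END TO END with a
  Temple certificate `T` at `F₋ₐ` against the transported level: `lowerRow_chord_of_levelShift_temple_closedShell`
  / `…_thresholds` (Temple: `lowerRow_of_temple`, Rows/TempleLowerRow.lean).
WHAT THIS IS NOT: not a certificate; not a statement that the chord is informative (its loss vs E₀ is the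
«price ratio» arithmetic of the LINE, floats until a row exists); no new axiom; no node. A chord ROW supplies
(i) the β-leg node of record (e.g. CERTIFIED-CHEM #332's `FlipDQGT1LowerNode` on `F_λ`), (ii) ONE moments /
Temple node at `F₋ₐ`, and instantiates `lowerRow_chord_of_levelShift_temple_closedShell` with its literals.
-/

noncomputable section

namespace Summit.Ventures.CertifiedQuantumChemistry

open Matrix

variable {k : ℕ}

/-! ## §1 Table identities of the two derived files -/

/-- **The shifted file of record is the level shift by `a + λ` of the compact-side file**:
`lincomb 1 (a + λ) (lincomb 1 (−a) F W) W = lincomb 1 λ F W` (entrywise on the three tables; `Model.ext'`). -/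
theorem Model.lincomb_compact_shift (F W : Model k) (a lam : ℚ) :
    Model.lincomb 1 (a + lam) (Model.lincomb 1 (-a) F W) W = Model.lincomb 1 lam F W :=
  Model.ext' (funext fun p => funext fun q => by simp only [Model.lincomb_h]; ring)
    (funext fun p => funext fun q => funext fun r => funext fun s => by simp only [Model.lincomb_eri]; ring)
    (by simp only [Model.lincomb_ecore]; ring)

/-- **`F` is the convex combination `(λ·F₋ₐ + a·F_λ)/(a + λ)` of the two certified files** (`a + λ ≠ 0`):
`lincomb (λ/(a+λ)) (a/(a+λ)) (lincomb 1 (−a) F W) (lincomb 1 λ F W) = F` (`Model.lincomb_lincomb`, `Model.lincomb_one_zero`). -/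
theorem Model.lincomb_chord (F W : Model k) {a lam : ℚ} (h : a + lam ≠ 0) :
    Model.lincomb (lam / (a + lam)) (a / (a + lam)) (Model.lincomb 1 (-a) F W) (Model.lincomb 1 lam F W) = F := by
  rw [Model.lincomb_lincomb]
  have h1 : lam / (a + lam) * 1 + a / (a + lam) * 1 = 1 := by
    field_simp
    ring
  have h2 : lam / (a + lam) * (-a) + a / (a + lam) * lam = 0 := by ring
  rw [h1, h2, Model.lincomb_one_zero]

/-! ## §2 Gap transport: the β leg certifies the spectral gap at the compact-side file -/

/-- **GAP TRANSPORT, closed shell.** Symmetric `F`, `a, λ ≥ 0`, reference orbital set `J`, any `μ`; a certified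
lower row `ℓ` of the shifted file `lincomb 1 λ F (diagWeight 1_J μ)` in sector `(|J|, |J|)`. Then, AT THE
COMPACT-SIDE FILE `F₋ₐ = lincomb 1 (−a) F (diagWeight 1_J μ)`: `GapCertificate F₋ₐ |J| |J| (ℓ − (a+λ)(2|J| − 1 − μ))`
(`= ℓ` for the door-M1 choice `μ = 2|J| − 1`) — since `F_λ` is the level shift of `F₋ₐ` by `a + λ ≥ 0`
(`Model.lincomb_compact_shift`) and `gapCertificate_of_lowerRow_closedShell` applies to the symmetric model `F₋ₐ`.
[cite: HornJohnson2013, Thm 4.2.6] -/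
theorem gapCertificate_compact_of_lowerRow_closedShell {F : Model k} (hF : F.IsSymmetric)
    (J : Finset (Fin k)) (μ : ℚ) {a lam ℓ : ℚ} (ha : 0 ≤ a) (hlam : 0 ≤ lam)
    (hL : LowerRow (Model.lincomb 1 lam F (Model.diagWeight (fun p => if p ∈ J then (1 : ℚ) else 0) μ))
      J.card J.card ℓ) :
    GapCertificate (Model.lincomb 1 (-a) F (Model.diagWeight (fun p => if p ∈ J then (1 : ℚ) else 0) μ))
      J.card J.card (ℓ - (a + lam) * (2 * J.card - 1 - μ)) := by
  have hW := Model.diagWeight_isSymmetric (fun p => if p ∈ J then (1 : ℚ) else 0) μ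
  have hFm := Model.lincomb_isSymmetric (α := 1) (β := -a) hF hW
  refine gapCertificate_of_lowerRow_closedShell hFm (by linarith) J μ ?_
  rw [Model.lincomb_compact_shift]
  exact hL

/-- **GAP TRANSPORT, threshold (open-shell) template.** The β leg of record on `lincomb 1 λ F (diagWeight w μ)`
in sector `(a, b)` with the threshold data of `gapCertificate_of_lowerRow_levelShift_thresholds` (`|Tα| = a`,
`|Tβ| = b`, inside/outside bounds) certifies, AT THE COMPACT-SIDE FILE `lincomb 1 (−t) F (diagWeight w μ)` (`t ≥ 0`),
the spectral gap level `ℓ − (t+λ)(Σ_{Tα} w + Σ_{Tβ} w − min(loα − hiα, loβ − hiβ) − μ)`. [cite: HornJohnson2013, Thm 4.2.6] -/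
theorem gapCertificate_compact_of_lowerRow_thresholds {F : Model k} (hF : F.IsSymmetric) {a b : ℕ}
    {t lam : ℚ} (ht : 0 ≤ t) (hlam : 0 ≤ lam) {w : Fin k → ℚ} {μ : ℚ} {Tα Tβ : Finset (Fin k)}
    (hTa : Tα.card = a) (hTb : Tβ.card = b) {loα hiα loβ hiβ : ℚ}
    (hloα : ∀ p ∈ Tα, loα ≤ w p) (hhiα : ∀ p ∉ Tα, w p ≤ hiα) (hα : hiα ≤ loα)
    (hloβ : ∀ p ∈ Tβ, loβ ≤ w p) (hhiβ : ∀ p ∉ Tβ, w p ≤ hiβ) (hβ : hiβ ≤ loβ)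
    {ℓ : ℚ} (hL : LowerRow (Model.lincomb 1 lam F (Model.diagWeight w μ)) a b ℓ) :
    GapCertificate (Model.lincomb 1 (-t) F (Model.diagWeight w μ)) a b
      (ℓ - (t + lam) * (∑ p ∈ Tα, w p + ∑ p ∈ Tβ, w p - min (loα - hiα) (loβ - hiβ) - μ)) := by
  have hW := Model.diagWeight_isSymmetric w μ
  have hFm := Model.lincomb_isSymmetric (α := 1) (β := -t) hF hW
  refine gapCertificate_of_lowerRow_levelShift_thresholds hFm (by linarith) hTa hTb hloα hhiα hα
    hloβ hhiβ hβ ?_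
  rw [Model.lincomb_compact_shift]
  exact hL

/-- **Temple lower row AT THE COMPACT-SIDE FILE** (closed shell): the β leg of record plus ONE Temple
certificate `T` at `F₋ₐ` against the transported level give `LowerRow F₋ₐ |J| |J| T` (`lowerRow_of_temple`).
[cite: Thirring2002QMP, (3.5.30; 2)] -/
theorem lowerRow_compact_of_levelShift_temple_closedShell {F : Model k} (hF : F.IsSymmetric)
    (J : Finset (Fin k)) (μ : ℚ) {a lam ℓ T : ℚ} (ha : 0 ≤ a) (hlam : 0 ≤ lam)
    (hL : LowerRow (Model.lincomb 1 lam F (Model.diagWeight (fun p => if p ∈ J then (1 : ℚ) else 0) μ))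
      J.card J.card ℓ)
    (hT : TempleCertificate (Model.lincomb 1 (-a) F (Model.diagWeight (fun p => if p ∈ J then (1 : ℚ) else 0) μ))
      J.card J.card T (ℓ - (a + lam) * (2 * J.card - 1 - μ))) :
    LowerRow (Model.lincomb 1 (-a) F (Model.diagWeight (fun p => if p ∈ J then (1 : ℚ) else 0) μ))
      J.card J.card T :=
  lowerRow_of_temple (Model.lincomb_isSymmetric hF (Model.diagWeight_isSymmetric _ _))
    (gapCertificate_compact_of_lowerRow_closedShell hF J μ ha hlam hL) hT

/-! ## §3 The chord row: operator concavity of the sector ground energy -/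

/-- **THE CHORD ROW (operator concavity).** Symmetric `F`, symmetric weight file `W`, `a, λ > 0`; certified
lower rows `T` of the compact-side file `lincomb 1 (−a) F W` and `β` of the shifted file `lincomb 1 λ F W` in the
same sector `(N, M)`. Then `LowerRow F N M ((λ·T + a·β)/(a + λ))` — `F` is the non-negative combination
`(λ·F₋ₐ + a·F_λ)/(a + λ)` (`Model.lincomb_chord`) and lower rows combine under non-negative coefficients
(`LowerRow.lincomb`, Rows/LinearCombination.lean: the sector ground energy is concave in the tables). -/
theorem LowerRow.chord {F W : Model k} (hF : F.IsSymmetric) (hW : W.IsSymmetric) {N M : ℕ}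
    {a lam T β : ℚ} (ha : 0 < a) (hlam : 0 < lam)
    (hT : LowerRow (Model.lincomb 1 (-a) F W) N M T) (hβ : LowerRow (Model.lincomb 1 lam F W) N M β) :
    LowerRow F N M (lam / (a + lam) * T + a / (a + lam) * β) := by
  have hs : 0 < a + lam := by linarith
  have h := LowerRow.lincomb (Model.lincomb_isSymmetric hF hW) (Model.lincomb_isSymmetric hF hW)
    (div_nonneg hlam.le hs.le) (div_nonneg ha.le hs.le) hT hβ
  rwa [Model.lincomb_chord F W hs.ne'] at h

/-- **END TO END, CLOSED SHELL — THE ONE-DECL CELL of a compact-chord row (door M1′).** Symmetric `F`;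
door-M1 weight `1_J, μ`; the shifted leg of record `LowerRow (lincomb 1 λ F (diagWeight 1_J μ)) |J| |J| ℓ`
(`λ > 0`); ONE Temple certificate `T` at the compact-side file `lincomb 1 (−a) F (diagWeight 1_J μ)` (`a > 0`)
against the transported gap level `ℓ − (a+λ)(2|J| − 1 − μ)` (`= ℓ` when `μ = 2|J| − 1`). Then
`LowerRow F |J| |J| ((λ·T + a·ℓ)/(a + λ))` — W2L3-P2 INSTANCE1-SPEC §(d)'s `L_chord = (λ·T + a·β_A)/(a + λ)`.
[cite: Thirring2002QMP, (3.5.30; 2)] -/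
theorem lowerRow_chord_of_levelShift_temple_closedShell {F : Model k} (hF : F.IsSymmetric)
    (J : Finset (Fin k)) (μ : ℚ) {a lam ℓ T : ℚ} (ha : 0 < a) (hlam : 0 < lam)
    (hL : LowerRow (Model.lincomb 1 lam F (Model.diagWeight (fun p => if p ∈ J then (1 : ℚ) else 0) μ))
      J.card J.card ℓ)
    (hT : TempleCertificate (Model.lincomb 1 (-a) F (Model.diagWeight (fun p => if p ∈ J then (1 : ℚ) else 0) μ))
      J.card J.card T (ℓ - (a + lam) * (2 * J.card - 1 - μ))) :
    LowerRow F J.card J.card (lam / (a + lam) * T + a / (a + lam) * ℓ) :=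
  LowerRow.chord hF (Model.diagWeight_isSymmetric _ _) ha hlam
    (lowerRow_compact_of_levelShift_temple_closedShell hF J μ ha.le hlam.le hL hT) hL

/-- **END TO END, THRESHOLD (OPEN-SHELL) TEMPLATE** (door M1′ on a doublet / weighted-template sector):
symmetric `F`; threshold weight data `(w, μ, Tα, Tβ, lo/hi)` with `|Tα| = a`, `|Tβ| = b`; the shifted leg of
record `LowerRow (lincomb 1 λ F (diagWeight w μ)) a b ℓ` (`λ > 0`); ONE Temple certificate `T` at the compact-side
file `lincomb 1 (−t) F (diagWeight w μ)` (`t > 0`) against the transported level. Then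
`LowerRow F a b ((λ·T + t·ℓ)/(t + λ))`. [cite: Thirring2002QMP, (3.5.30; 2)] -/
theorem lowerRow_chord_of_levelShift_temple_thresholds {F : Model k} (hF : F.IsSymmetric)
    {a b : ℕ} {t lam : ℚ} (ht : 0 < t) (hlam : 0 < lam) {w : Fin k → ℚ} {μ : ℚ}
    {Tα Tβ : Finset (Fin k)} (hTa : Tα.card = a) (hTb : Tβ.card = b) {loα hiα loβ hiβ : ℚ}
    (hloα : ∀ p ∈ Tα, loα ≤ w p) (hhiα : ∀ p ∉ Tα, w p ≤ hiα) (hα : hiα ≤ loα)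
    (hloβ : ∀ p ∈ Tβ, loβ ≤ w p) (hhiβ : ∀ p ∉ Tβ, w p ≤ hiβ) (hβ : hiβ ≤ loβ)
    {ℓ : ℚ} (hL : LowerRow (Model.lincomb 1 lam F (Model.diagWeight w μ)) a b ℓ) {T : ℚ}
    (hT : TempleCertificate (Model.lincomb 1 (-t) F (Model.diagWeight w μ)) a b T
      (ℓ - (t + lam) * (∑ p ∈ Tα, w p + ∑ p ∈ Tβ, w p - min (loα - hiα) (loβ - hiβ) - μ))) :
    LowerRow F a b (lam / (t + lam) * T + t / (t + lam) * ℓ) := by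
  have hW := Model.diagWeight_isSymmetric w μ
  have hrow : LowerRow (Model.lincomb 1 (-t) F (Model.diagWeight w μ)) a b T :=
    lowerRow_of_temple (Model.lincomb_isSymmetric hF hW)
      (gapCertificate_compact_of_lowerRow_thresholds hF ht.le hlam.le hTa hTb hloα hhiα hα hloβ hhiβ hβ hL) hT
  exact LowerRow.chord hF hW ht hlam hrow hL

end Summit.Ventures.CertifiedQuantumChemistry

end
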